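import Mathlib.Analysis.Normed.Affine.MazurUlam
import Literature.Geometry.DiscreteGeometry.LayerStackings
import Literature.Geometry.DiscreteGeometry.LayerShellPatterns
import Summits.AtomisticToContinuum.Crystallization.Theorems.PalmUnimodularRigidityLayeredLawsSelectHcpLocalCongruenceSites
import Summits.AtomisticToContinuum.Crystallization.Theorems.PricedLinkCensusStackingHingeWords
import Summits.AtomisticToContinuum.Crystallization.Theorems.PricedLinkCensusSoftLayerPropagationBasics

/-!
# Route `PricedLinkCensus`, crux `StackingHinge` (stmt-AtomisticToContinuum-14993), line `Sketch`:
# exact-star rigidity at the IDEAL ratio (`stub_idealStarRigidity`)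

Pure geometry, no potential, no measure.  At the ideal ratio `h₀ = a₀ √(2/3)` the relaxed-hcp
reference star `refStar a₀ h₀` is the ideal anticuboctahedron and `a₀ • fccKissingPattern` the ideal
cuboctahedron, all twelve struts of length `a₀`.  If `0 ∈ S` and at EVERY `x ∈ S` the punctured
`5/4`-ball of `S − x` is a rotated copy of one of the two, then `S` is an exact rotated Barlow
stacking `A '' barlowStacking a₀ (a₀√(2/3)) s'` for a Hägg word `s'` and a LINEAR isometry `A`.

Proof (Hales, *Dense Sphere Packings* §1.3, in the tree as the PROVED
`Literature.Geometry.DiscreteGeometry.HalesDSP_layerPackings_holds`):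

* all star points have norm exactly `a₀` (`norm_of_mem_refStar`: the integer metric `siteQ` of the
  twelve labels against the root is `(12,0)` or `(4,1)`, `star_pairs`), so two points of `S` are
  `≥ a₀` apart and the punctured `5/4`-ball of `S − x` is `{y | x + y ∈ S, ‖y‖ = a₀}`;
* `V := {v | (a₀/2) • v ∈ S}` is a packing of unit balls whose kissing shells are
  `(2/a₀) • A '' refStar a₀ h₀ = A '' refStar 2 (2√(2/3))` — the kissing shell of `0` in Hales's
  `hcpStacking 2 (2√(2/3))` (`coe_refStar_two_eq_kissingShell`, by inclusion and the count
  `ncard_kissingShell_barlowStacking`), an HCP pattern (`isArrangedIn_kissingShell_hcpStacking`) —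
  or `A '' (2 • fccKissingPattern)`, an FCC pattern;
* `HalesDSP_layerPackings_holds` gives `V = g '' barlowStacking 2 (2√(2/3)) s`; re-rooting at the
  preimage of `0` (`mem_barlowStacking_iff_sub_mem_shift`: the stacking seen from one of its points is
  the stacking of the shifted word) makes the isometry fix `0`, hence linear (Mazur–Ulam,
  `IsometryEquiv.toRealLinearIsometryEquivOfMapZero`); unscale with `barlowStacking_eq_smul`.

All `[folklore]` given the cited tree theorems.
-/

noncomputable section

namespace Summit.AtomisticToContinuum.Crystallization.Theorems.PricedHcpWindowsIdealStarRigidity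

open Literature.MathematicalPhysics.StatisticalMechanics Literature.Geometry.DiscreteGeometry
open Summit.AtomisticToContinuum.Crystallization.Theorems.PalmUnimodularRigidity.LayeredLawsSelectHcp
open scoped Pointwise

/-! ## The reference star: scaling, norms, the ideal star as a kissing shell -/

/-- **hcp sites scale**: `r • hcpSite a h v = hcpSite (r a) (r h) v`. [folklore] -/
theorem smul_hcpSite (r a h : ℝ) (v : ℤ × ℤ × ℤ) :
    r • hcpSite a h v = hcpSite (r * a) (r * h) v := by
  ext l
  fin_cases l <;> simp [hcpSite] <;> ring

/-- **The reference star scales**: `r • refStar a h = refStar (r a) (r h)` as point sets. [folklore] -/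
theorem smul_coe_refStar (r a h : ℝ) :
    r • (refStar a h : Set (EuclideanSpace ℝ (Fin 3))) =
      (refStar (r * a) (r * h) : Set (EuclideanSpace ℝ (Fin 3))) := by
  rw [refStar, refStar, Finset.coe_image, Finset.coe_image, ← Set.image_smul, Set.image_image]
  exact Set.image_congr' fun v => smul_hcpSite r a h v

/-- **At the ideal ratio `h² = ⅔ a²` every strut of the reference star has length `a`**: the
integer metric of a star label against the root is `(12, 0)` (in-layer) or `(4, 1)` (polar), and
`a²/12 · 4 + ⅔ a² = a²`. [folklore] -/
theorem norm_hcpSite_of_mem_hcpStarIdx {a h : ℝ} (ha : 0 ≤ a) (hh : h ^ 2 = 2 / 3 * a ^ 2)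
    {v : ℤ × ℤ × ℤ} (hv : v ∈ hcpStarIdx) : ‖hcpSite a h v‖ = a := by
  obtain ⟨m, rfl⟩ := exists_starLab_eq hv
  have hsq := hcpSite_dist_sq a h (starLab m) 0
  rw [hcpSite_zero, dist_zero_right] at hsq
  have h2 : ‖hcpSite a h (starLab m)‖ ^ 2 = a ^ 2 := by
    rcases star_pairs.2 m with hq | hq <;> rw [hq] at hsq <;> push_cast at hsq <;> nlinarith
  exact (pow_left_inj₀ (norm_nonneg _) ha two_ne_zero).1 h2

/-- Every point of the ideal reference star `refStar a h`, `h² = ⅔ a²`, has norm `a`. [folklore] -/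
theorem norm_of_mem_refStar {a h : ℝ} (ha : 0 ≤ a) (hh : h ^ 2 = 2 / 3 * a ^ 2)
    {y : EuclideanSpace ℝ (Fin 3)} (hy : y ∈ (refStar a h : Set (EuclideanSpace ℝ (Fin 3)))) :
    ‖y‖ = a := by
  rw [refStar, Finset.coe_image] at hy
  obtain ⟨v, hv, rfl⟩ := hy
  exact norm_hcpSite_of_mem_hcpStarIdx ha hh hv

/-- For `a, h > 0` the site map `hcpSite a h` is injective (uniform discreteness
`le_dist_barlowPos`). [folklore] -/
theorem hcpSite_injective {a h : ℝ} (ha : 0 < a) (hh : 0 < h) :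
    Function.Injective (hcpSite a h) := by
  rintro ⟨k, i, j⟩ ⟨k', i', j'⟩ heq
  by_contra hne
  have hle := le_dist_barlowPos a h alternatingHagg ha.le hh.le hne
  have heq' : barlowPos a h alternatingHagg k i j = barlowPos a h alternatingHagg k' i' j' := heq
  rw [heq', dist_self] at hle
  exact absurd hle (not_le.2 (lt_min ha hh))

/-- The reference star has twelve points (`a, h > 0`). [folklore] -/
theorem card_refStar {a h : ℝ} (ha : 0 < a) (hh : 0 < h) : (refStar a h).card = 12 := by
  rw [refStar, Finset.card_image_of_injective _ (hcpSite_injective ha hh), card_hcpStarIdx]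

/-- **The ideal reference star at Hales's scale is the kissing shell of the origin of the HCP
packing `hcpStacking 2 (2√(2/3))`**: its twelve points are points of the stacking at distance `2`
from `0`, and there are exactly twelve such points (`ncard_kissingShell_barlowStacking`).
[folklore] -/
theorem coe_refStar_two_eq_kissingShell :
    (refStar 2 layerSpacing : Set (EuclideanSpace ℝ (Fin 3))) =
      kissingShell (hcpStacking 2 layerSpacing) 0 := by
  have hsub : (refStar 2 layerSpacing : Set (EuclideanSpace ℝ (Fin 3))) ⊆
      kissingShell (hcpStacking 2 layerSpacing) 0 := by
    intro y hy
    refine ⟨?_, norm_of_mem_refStar zero_le_two layerSpacing_sq' hy⟩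
    rw [refStar, Finset.coe_image] at hy
    obtain ⟨v, -, rfl⟩ := hy
    rw [zero_add]
    show barlowPos 2 layerSpacing alternatingHagg v.1 v.2.1 v.2.2 ∈
      barlowStacking 2 layerSpacing alternatingHagg
    exact barlowPos_mem _ _ _
  have h12 : (kissingShell (hcpStacking 2 layerSpacing) 0).ncard = 12 := by
    have h0 : barlowPos 2 layerSpacing alternatingHagg 0 0 0 = 0 := hcpSite_zero 2 layerSpacing
    have h := ncard_kissingShell_barlowStacking isHaggSeq_alternating 0 0 0
    rw [h0] at h
    exact h
  refine Set.eq_of_subset_of_ncard_le hsub ?_ (Set.finite_of_ncard_ne_zero (by rw [h12]; norm_num))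
  rw [h12, Set.ncard_coe_finset, card_refStar two_pos layerSpacing_pos]

/-- **The ideal reference star at Hales's scale is arranged in the HCP pattern** (an
anticuboctahedron): it is the tangent arrangement of a ball of the HCP packing.
[cite: HalesDSP2012, §1.3 (p. 12)] [folklore] -/
theorem isArrangedIn_refStar_two :
    IsArrangedIn (refStar 2 layerSpacing : Set (EuclideanSpace ℝ (Fin 3))) hcpKissingPattern := by
  rw [coe_refStar_two_eq_kissingShell]
  exact isArrangedIn_kissingShell_hcpStacking ⟨0, 0, 0, (hcpSite_zero 2 layerSpacing).symm⟩

/-! ## Transport of arrangements and of scaled sets by linear isometries -/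

/-- Arrangement in a pattern is transported by a linear isometry of the ambient space.
[folklore] -/
theorem isArrangedIn_image (A : EuclideanSpace ℝ (Fin 3) ≃ₗᵢ[ℝ] EuclideanSpace ℝ (Fin 3))
    {T : Set (EuclideanSpace ℝ (Fin 3))} {P : Finset (EuclideanSpace ℝ (Fin 3))}
    (hT : IsArrangedIn T P) : IsArrangedIn (A '' T) P := by
  obtain ⟨B, rfl⟩ := hT
  refine ⟨A.toLinearIsometry.comp B, ?_⟩
  rw [Set.image_image]
  refine Set.image_congr' fun p => ?_
  simp only [LinearIsometry.coe_comp, Function.comp_apply, LinearIsometryEquiv.coe_toLinearIsometry,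
    LinearIsometryEquiv.map_smul]

/-- A linear isometry commutes with scaling of point sets: `c • A '' X = A '' (c • X)`. [folklore] -/
theorem smul_set_image (A : EuclideanSpace ℝ (Fin 3) ≃ₗᵢ[ℝ] EuclideanSpace ℝ (Fin 3)) (c : ℝ)
    (X : Set (EuclideanSpace ℝ (Fin 3))) : c • (A '' X) = A '' (c • X) := by
  ext y
  simp only [Set.mem_smul_set, Set.mem_image]
  constructor
  · rintro ⟨_, ⟨x, hx, rfl⟩, rfl⟩
    exact ⟨c • x, ⟨x, hx, rfl⟩, LinearIsometryEquiv.map_smul (e := A) c x⟩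
  · rintro ⟨_, ⟨x, hx, rfl⟩, rfl⟩
    exact ⟨A x, ⟨x, hx, rfl⟩, (LinearIsometryEquiv.map_smul (e := A) c x).symm⟩

/-! ## The reduction to Hales, *Dense Sphere Packings* §1.3 -/

/-- **Ideal two-type shells force a Barlow stacking.**  Let `a > 0` and `S ∋ 0` be a set in `ℝ³`
whose points are pairwise `≥ a` apart and such that, at every `x ∈ S`, the points `y` with
`x + y ∈ S`, `‖y‖ = a` form a linearly rotated copy of the ideal reference star
`refStar a (a√(2/3))` or of the ideal cuboctahedron `a • fccKissingPattern`.  Then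
`S = A '' barlowStacking a (a√(2/3)) s'` for a linear isometry `A` and a Hägg word `s'`.
Reduction: `V := {v | (a/2) • v ∈ S}` is a packing of unit balls with FCC/HCP kissing shells,
`HalesDSP_layerPackings_holds`, re-rooting at `0` (`mem_barlowStacking_iff_sub_mem_shift`),
Mazur–Ulam, unscaling (`barlowStacking_eq_smul`). [folklore] -/
theorem barlow_of_idealShells {a : ℝ} (ha : 0 < a) {S : Set (EuclideanSpace ℝ (Fin 3))}
    (h0 : (0 : EuclideanSpace ℝ (Fin 3)) ∈ S)
    (hsep : ∀ x ∈ S, ∀ z ∈ S, x ≠ z → a ≤ dist x z)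
    (hshell : ∀ x ∈ S, ∃ A : EuclideanSpace ℝ (Fin 3) ≃ₗᵢ[ℝ] EuclideanSpace ℝ (Fin 3),
      {y : EuclideanSpace ℝ (Fin 3) | x + y ∈ S ∧ ‖y‖ = a} =
          A '' (refStar a (a * Real.sqrt (2 / 3)) : Set (EuclideanSpace ℝ (Fin 3))) ∨
        {y : EuclideanSpace ℝ (Fin 3) | x + y ∈ S ∧ ‖y‖ = a} =
          A '' ((fun p : EuclideanSpace ℝ (Fin 3) => a • p) ''
            (fccKissingPattern : Set (EuclideanSpace ℝ (Fin 3))))) :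
    ∃ A : EuclideanSpace ℝ (Fin 3) ≃ₗᵢ[ℝ] EuclideanSpace ℝ (Fin 3), ∃ s' : ℤ → ℤ, IsHaggSeq s' ∧
      S = A '' barlowStacking a (a * Real.sqrt (2 / 3)) s' := by
  -- the scale `t = a / 2` and the scaled set `V = t⁻¹ • S`
  set t : ℝ := a / 2 with ht_def
  have ht : 0 < t := by positivity
  have hta : t * 2 = a := by rw [ht_def]; ring
  have htinv : t⁻¹ * a = 2 := by rw [ht_def, inv_div, div_mul_cancel₀ _ ha.ne']
  set V : Set (EuclideanSpace ℝ (Fin 3)) := {v | t • v ∈ S} with hV_def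
  have hV0 : (0 : EuclideanSpace ℝ (Fin 3)) ∈ V := by
    show t • (0 : EuclideanSpace ℝ (Fin 3)) ∈ S
    rw [smul_zero]
    exact h0
  -- `V` is a packing of unit balls
  have hpack : IsUnitBallPacking V := by
    intro v hv w hw hvw
    by_contra hne
    have hne' : t • v ≠ t • w := fun h => hne (smul_right_injective (EuclideanSpace ℝ (Fin 3)) ht.ne' h)
    have hle := hsep _ hv _ hw hne'
    rw [dist_smul₀, Real.norm_of_nonneg ht.le] at hle
    nlinarith [mul_lt_mul_of_pos_left hvw ht]
  -- every kissing shell of `V` is an FCC or an HCP pattern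
  have hshells : HasFccOrHcpShells V := by
    intro u hu
    obtain ⟨A, hA⟩ := hshell (t • u) hu
    have hK : kissingShell V u = t⁻¹ • {y : EuclideanSpace ℝ (Fin 3) | t • u + y ∈ S ∧ ‖y‖ = a} := by
      ext z
      rw [Set.mem_inv_smul_set_iff₀ ht.ne', mem_kissingShell_iff]
      simp only [Set.mem_setOf_eq, hV_def, smul_add, norm_smul, Real.norm_of_nonneg ht.le]
      constructor
      · rintro ⟨h1, h2⟩
        exact ⟨h1, by rw [h2, hta]⟩
      · rintro ⟨h1, h2⟩
        exact ⟨h1, mul_left_cancel₀ ht.ne' (h2.trans hta.symm)⟩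
    rw [hK]
    rcases hA with hA | hA
    · refine Or.inr ?_
      rw [hA, smul_set_image, smul_coe_refStar, ← mul_assoc, htinv]
      exact isArrangedIn_image A isArrangedIn_refStar_two
    · refine Or.inl ?_
      rw [hA, smul_set_image, Set.image_smul, smul_smul, htinv, ← Set.image_smul]
      exact isArrangedIn_image A (isArrangedIn_self _)
  -- Hales, Dense Sphere Packings §1.3
  obtain ⟨s, hs, g, hVg⟩ := HalesDSP_layerPackings_holds V hpack ⟨0, hV0⟩ hshells
  -- re-rooting at `0 ∈ V`
  have h0V := hV0
  rw [hVg] at h0V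
  obtain ⟨z₀, ⟨m, i₀, j₀, rfl⟩, hgz₀⟩ := h0V
  set s' : ℤ → ℤ := fun n => s (n + m) with hs'_def
  have hs' : IsHaggSeq s' := isHaggSeq_shift hs m
  set g' : EuclideanSpace ℝ (Fin 3) ≃ᵢ EuclideanSpace ℝ (Fin 3) :=
    (IsometryEquiv.addRight (barlowPos 2 (2 * Real.sqrt (2 / 3)) s m i₀ j₀)).trans g with hg'_def
  have hg'apply : ∀ x, g' x = g (x + barlowPos 2 (2 * Real.sqrt (2 / 3)) s m i₀ j₀) := fun x => by
    simp [hg'_def]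
  have hg'0 : g' 0 = 0 := by rw [hg'apply, zero_add, hgz₀]
  set L : EuclideanSpace ℝ (Fin 3) ≃ₗᵢ[ℝ] EuclideanSpace ℝ (Fin 3) :=
    g'.toRealLinearIsometryEquivOfMapZero hg'0 with hL_def
  have hL : ∀ x, L x = g (x + barlowPos 2 (2 * Real.sqrt (2 / 3)) s m i₀ j₀) := fun x => by
    rw [hL_def, IsometryEquiv.coe_toRealLinearIsometryEquivOfMapZero, hg'apply]
  have hVL : V = L '' barlowStacking 2 (2 * Real.sqrt (2 / 3)) s' := by
    rw [hVg]
    ext v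
    constructor
    · rintro ⟨z, hz, rfl⟩
      refine ⟨z - barlowPos 2 (2 * Real.sqrt (2 / 3)) s m i₀ j₀,
        (mem_barlowStacking_iff_sub_mem_shift (m := m) (i₀ := i₀) (j₀ := j₀) z).1 hz, ?_⟩
      rw [hL, sub_add_cancel]
    · rintro ⟨w, hw, rfl⟩
      refine ⟨w + barlowPos 2 (2 * Real.sqrt (2 / 3)) s m i₀ j₀, ?_, (hL w).symm⟩
      refine (mem_barlowStacking_iff_sub_mem_shift (m := m) (i₀ := i₀) (j₀ := j₀) _).2 ?_
      rwa [add_sub_cancel_right]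
  -- unscale
  have hSV : S = t • V := by
    ext x
    rw [Set.mem_smul_set_iff_inv_smul_mem₀ ht.ne', hV_def, Set.mem_setOf_eq, smul_inv_smul₀ ht.ne']
  refine ⟨L, s', hs', ?_⟩
  rw [hSV, hVL, smul_set_image, barlowStacking_eq_smul 2 (Real.sqrt (2 / 3)) s', smul_smul, hta,
    ← barlowStacking_eq_smul]

/-! ## The stub -/

/-- **stub_idealStarRigidity** (line `Sketch` of crux `StackingHinge`, pure geometry).  IDEAL RATIO
`h₀ = a₀ √(2/3)`: `refStar a₀ h₀` is the ideal anticuboctahedron and `a₀ • fccKissingPattern` the ideal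
cuboctahedron, all twelve struts of length `a₀`.  If `0 ∈ S` and at EVERY `x ∈ S` the punctured
`5/4`-ball of `S − x` is a rotated copy of one of the two, then `S` is an exact rotated Barlow
stacking `A '' barlowStacking a₀ h s'` with `h = h₀ = a₀√(2/3)` and `s'` a Hägg word.  Proof: all
star points have norm `a₀ ≤ 199/200 < 5/4`, so two points of `S` are `≥ a₀` apart and the punctured
`5/4`-ball of `S − x` is `{y | x + y ∈ S, ‖y‖ = a₀}`; conclude by `barlow_of_idealShells` (Hales,
*Dense Sphere Packings* §1.3, `HalesDSP_layerPackings_holds`, re-rooted and unscaled). [folklore] -/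
theorem stub_idealStarRigidity : ∀ a₀ h₀ : ℝ, 189 / 200 ≤ a₀ → a₀ ≤ 199 / 200 → 77 / 100 ≤ h₀ → h₀ ≤ 163 / 200 → h₀ = a₀ * Real.sqrt (2 / 3) → ∀ S : Set (EuclideanSpace ℝ (Fin 3)), (0 : EuclideanSpace ℝ (Fin 3)) ∈ S → (∀ x ∈ S, ∃ A : EuclideanSpace ℝ (Fin 3) ≃ₗᵢ[ℝ] EuclideanSpace ℝ (Fin 3), ({y : EuclideanSpace ℝ (Fin 3) | y ∈ ((fun p : EuclideanSpace ℝ (Fin 3) => p - x) '' S) ∧ y ≠ 0 ∧ ‖y‖ ≤ 5 / 4} = A '' (↑(Summit.AtomisticToContinuum.Crystallization.Theorems.PalmUnimodularRigidity.LayeredLawsSelectHcp.refStar a₀ h₀) : Set (EuclideanSpace ℝ (Fin 3))) ∨ {y : EuclideanSpace ℝ (Fin 3) | y ∈ ((fun p : EuclideanSpace ℝ (Fin 3) => p - x) '' S) ∧ y ≠ 0 ∧ ‖y‖ ≤ 5 / 4} = A '' ((fun p : EuclideanSpace ℝ (Fin 3) => a₀ • p) '' (↑Literature.Geometry.DiscreteGeometry.fccKissingPattern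 : Set (EuclideanSpace ℝ (Fin 3)))))) → ∃ A : EuclideanSpace ℝ (Fin 3) ≃ₗᵢ[ℝ] EuclideanSpace ℝ (Fin 3), ∃ h : ℝ, (h = h₀ ∨ h = a₀ * Real.sqrt (2 / 3)) ∧ ∃ s' : ℤ → ℤ, Literature.MathematicalPhysics.StatisticalMechanics.IsHaggSeq s' ∧ S = A '' Literature.MathematicalPhysics.StatisticalMechanics.barlowStacking a₀ h s' := by
  intro a₀ h₀ ha1 ha2 _ _ hid S h0 hS
  subst hid
  have ha : 0 < a₀ := by linarith
  have hh : (a₀ * Real.sqrt (2 / 3)) ^ 2 = 2 / 3 * a₀ ^ 2 := by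
    rw [mul_pow, Real.sq_sqrt (by norm_num : (0 : ℝ) ≤ 2 / 3)]; ring
  -- every point of either reference star has norm `a₀`
  have hnorm : ∀ (A : EuclideanSpace ℝ (Fin 3) ≃ₗᵢ[ℝ] EuclideanSpace ℝ (Fin 3))
      (T : Set (EuclideanSpace ℝ (Fin 3))),
      (T = A '' (refStar a₀ (a₀ * Real.sqrt (2 / 3)) : Set (EuclideanSpace ℝ (Fin 3))) ∨
        T = A '' ((fun p : EuclideanSpace ℝ (Fin 3) => a₀ • p) ''
          (fccKissingPattern : Set (EuclideanSpace ℝ (Fin 3))))) →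
      ∀ y ∈ T, ‖y‖ = a₀ := by
    rintro A T (rfl | rfl) y ⟨p, hp, rfl⟩
    · rw [LinearIsometryEquiv.norm_map]
      exact norm_of_mem_refStar ha.le hh hp
    · rw [LinearIsometryEquiv.norm_map]
      obtain ⟨q, hq, rfl⟩ := hp
      rw [norm_smul, Real.norm_of_nonneg ha.le, norm_eq_one_of_mem_fccKissingPattern hq, mul_one]
  -- two points of `S` are `≥ a₀` apart
  have hsep : ∀ x ∈ S, ∀ z ∈ S, x ≠ z → a₀ ≤ dist x z := by
    intro x hx z hz hxz
    by_contra hlt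
    rw [not_le] at hlt
    obtain ⟨A, hA⟩ := hS x hx
    have hmem : z - x ∈ {y : EuclideanSpace ℝ (Fin 3) |
        y ∈ ((fun p : EuclideanSpace ℝ (Fin 3) => p - x) '' S) ∧ y ≠ 0 ∧ ‖y‖ ≤ 5 / 4} :=
      ⟨⟨z, hz, rfl⟩, sub_ne_zero.2 (Ne.symm hxz), by rw [← dist_eq_norm, dist_comm]; linarith⟩
    have h := hnorm A _ hA _ hmem
    rw [← dist_eq_norm, dist_comm] at h
    linarith
  -- the punctured `5/4`-ball of `S − x` is the set of `y` with `x + y ∈ S` and `‖y‖ = a₀`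
  have hshell : ∀ x ∈ S, ∃ A : EuclideanSpace ℝ (Fin 3) ≃ₗᵢ[ℝ] EuclideanSpace ℝ (Fin 3),
      {y : EuclideanSpace ℝ (Fin 3) | x + y ∈ S ∧ ‖y‖ = a₀} =
          A '' (refStar a₀ (a₀ * Real.sqrt (2 / 3)) : Set (EuclideanSpace ℝ (Fin 3))) ∨
        {y : EuclideanSpace ℝ (Fin 3) | x + y ∈ S ∧ ‖y‖ = a₀} =
          A '' ((fun p : EuclideanSpace ℝ (Fin 3) => a₀ • p) ''
            (fccKissingPattern : Set (EuclideanSpace ℝ (Fin 3)))) := by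
    intro x hx
    obtain ⟨A, hA⟩ := hS x hx
    have hP : {y : EuclideanSpace ℝ (Fin 3) |
          y ∈ ((fun p : EuclideanSpace ℝ (Fin 3) => p - x) '' S) ∧ y ≠ 0 ∧ ‖y‖ ≤ 5 / 4} =
        {y : EuclideanSpace ℝ (Fin 3) | x + y ∈ S ∧ ‖y‖ = a₀} := by
      ext y
      constructor
      · intro hy
        refine ⟨?_, hnorm A _ hA y hy⟩
        obtain ⟨⟨p, hp, hpy⟩, -, -⟩ := hy
        rw [← hpy]
        simpa using hp
      · rintro ⟨hy, hyn⟩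
        refine ⟨⟨x + y, hy, by simp⟩, ?_, by rw [hyn]; linarith⟩
        rw [← norm_pos_iff, hyn]
        exact ha
    refine ⟨A, ?_⟩
    rw [← hP]
    exact hA
  obtain ⟨A, s', hs', hSeq⟩ := barlow_of_idealShells ha h0 hsep hshell
  exact ⟨A, a₀ * Real.sqrt (2 / 3), Or.inl rfl, s', hs', hSeq⟩

end Summit.AtomisticToContinuum.Crystallization.Theorems.PricedHcpWindowsIdealStarRigidity

end
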